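import Summits.QuantumAdvantage.QuantumAdvantage.Theorems.HintDialLeakLaw
import Literature.Barriers.QuantumAdvantage.TQBFMembership
import Summits.QuantumAdvantage.QuantumAdvantage.Theorems.CubicForrelationExactPairsMaioranaMcFarlandDefectVanishing

/-!
# HintDialPlanting — module 5/10 of the HintDial THEOREMS package (cell decomp-qadv, lens-3 generation 6)

§4c: the planted family `F_w`, its dual `G0 w`, the planted instance, the literal-projection calculus (`IsLit`, `IsProj`) and code length.

Provenance: split of the farm-checked single file `HintDialTheorems.lean` (HOME/decomp-qadv-lens-3/g6/tree/; rc 0 · no proof holes ·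
axioms ⊆ {propext, Classical.choice, Quot.sound}); mathematical record: HOME/decomp-qadv-lens-3/g6/NODE-g6.md.  Modules in order:
HintDialDuality → HintDialLevels → HintDialAutomaton → HintDialLeakLaw → HintDialPlanting → HintDialClosure → HintDialTable → HintDialLowDegree → HintDialAnfLadder → HintDialCovariance (each imports its predecessor).  Namespace `Summit.QuantumAdvantage.QuantumAdvantage.Theorems.HintDial`.
-/

set_option linter.dupNamespace false

noncomputable section

namespace Summit.QuantumAdvantage.QuantumAdvantage.Theorems.HintDial

open Finset
open Literature.Computability.Complexity
open Literature.Computability.QuantumComplexity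
open Literature.Computability.MetaComplexity
open _root_.Computability (encodeNat)
namespace Automaton

open CubicForm (bit)
open DerivativeWalsh (W)
open BuzetChailloux (bxor zeroVec)

variable {m : ℕ}
variable (w : Fin m → Bool)

/-! ### `F_w`, its dual `G₀ = F̃_w`, and the planted instance -/

/-- The cross block of `F_w` in coordinates. -/
def QQ (a b : Fin (kk m)) : Bool := qEnt w (nd.symm a) (nd.symm b)

/-- ★ `F_w(x′,x″) = ⟨x′, N_w x″ ⊕ e_{a₀}⟩ ⊕ x″_{b₀}` as a cubic table (all entries literals of `w`). -/
def Fw : CubicForm (kk m + kk m) := blTable (kk m) false (sgl a₀) (QQ w) (sgl b₀)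

/-- `R_w(b,a) = (N_w⁻¹)_{b,a}` (parity of the number of monotone paths `a ⇝ b` in the layered graph). -/
def rEnt (b a : Fin (kk m)) : Bool := ofNV (nsolve w (single (nd.symm a))) b

/-- `z = N_w⁻¹ e_{a₀}` (the run of the counter from every node). -/
def zv : Fin (kk m) → Bool := fun b => rEnt w b a₀

/-- ★ THE DUAL `G₀ = F̃_w` as a cubic table: constant `z_{b₀}` (THE DUAL BIT), linear part `R(b₀,·)` / `z`, cross block `Rᵀ`.
It has NO entries at cubic positions (`G0_noCubic`), and its entries are path parities of unbounded degree in `w`. -/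
def G0 : CubicForm (kk m + kk m) := blTable (kk m) (zv w b₀) (fun a => rEnt w b₀ a) (fun a b => rEnt w b a) (zv w)

/-- `Q_w · x″ = N_w x″` (coordinates vs nodes). -/
theorem mv_QQ (x₂ : Fin (kk m) → Bool) : mv (QQ w) x₂ = ofNV (nmul w (toNV x₂)) := by
  funext i
  obtain ⟨⟨r, s⟩, rfl⟩ := nd.surjective i
  apply bit_injective
  rw [mv, bit_bd]
  simp only [ofNV, Equiv.symm_apply_apply]
  rw [← Equiv.sum_comp (nd (m := m))]
  simp only [QQ, Equiv.symm_apply_apply, qEnt, bit_xor, add_mul, sum_add_distrib]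
  rw [sum_bit_decide_eq_mul]
  induction r using Fin.cases with
  | zero =>
    simp only [edgeB_zero, bit_false, zero_mul, sum_const_zero, add_zero, nmul_zero, toNV]
  | succ r' =>
    simp only [edgeB_succ, nmul_succ, toNV, bit_xor]
    rw [sum_bit_decide_eq_mul']

/-- `π_w(x″) = N_w x″ ⊕ e_{a₀}` in coordinates, -/
def pv (x₂ : Fin (kk m) → Bool) : Fin (kk m) → Bool := bxor (mv (QQ w) x₂) (sgl a₀)

/-- and its inverse `π_w⁻¹(y′) = N_w⁻¹(y′ ⊕ e_{a₀})`. -/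
def qv (y₁ : Fin (kk m) → Bool) : Fin (kk m) → Bool := ofNV (nsolve w (toNV (bxor y₁ (sgl a₀))))

/-- HintDial helper `pv_eq_iff` (lens-3 g6 HintDial THEOREMS package; see the enclosing section docstring). -/
theorem pv_eq_iff (x₂ y₁ : Fin (kk m) → Bool) : pv w x₂ = y₁ ↔ x₂ = qv w y₁ := by
  constructor
  · intro h
    have h1 : mv (QQ w) x₂ = bxor y₁ (sgl a₀) := by rw [← h, pv, Summit.QuantumAdvantage.QuantumAdvantage.Theorems.CubicForrelation.ExactPairsMaioranaMcFarland.dv_bxor_cancel_right]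
    rw [mv_QQ] at h1
    have h2 : nmul w (toNV x₂) = toNV (bxor y₁ (sgl a₀)) := by rw [← toNV_ofNV (nmul w (toNV x₂)), h1]
    have h3 : toNV x₂ = nsolve w (toNV (bxor y₁ (sgl a₀))) := nmul_injective w (by rw [h2, nmul_nsolve])
    rw [qv, ← h3, ofNV_toNV]
  · rintro rfl
    rw [pv, mv_QQ, qv, toNV_ofNV, nmul_nsolve, ofNV_toNV, Summit.QuantumAdvantage.QuantumAdvantage.Theorems.CubicForrelation.ExactPairsMaioranaMcFarland.dv_bxor_cancel_right]

/-- `F_w(x′,x″) = ⟨x′, π_w(x″)⟩ ⊕ x″_{b₀}`. -/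
theorem eval_Fw (x₁ x₂ : Fin (kk m) → Bool) : (Fw w).eval (Fin.append x₁ x₂) = xor (bd x₁ (pv w x₂)) (x₂ b₀) := by
  rw [Fw, eval_blTable, Bool.false_xor, pv, bd_bxor_right, bd_sgl_right, bd_sgl_left, bd_sgl_left]
  cases x₁ a₀ <;> cases x₂ b₀ <;> cases bd x₁ (mv (QQ w) x₂) <;> rfl

/-- ★ THE WALSH TRANSFORM OF `(-1)^{F_w}` (Maiorana–McFarland): `W(y′,y″) = 2^k · (-1)^{q_{b₀} ⊕ ⟨q,y″⟩}`, `q = π_w⁻¹(y′)`. -/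
theorem W_Fw (y₁ y₂ : Fin (kk m) → Bool) :
    W (fun x => signOf ((Fw w).eval x)) (Fin.append y₁ y₂) = 2 ^ kk m * (signOf (qv w y₁ b₀) * twist (qv w y₁) y₂) := by
  rw [DerivativeWalsh.W, sum_append]
  simp_rw [eval_Fw, twist_append, signOf_xor, signOf_bd]
  rw [sum_comm]
  have inner : ∀ x₂ : Fin (kk m) → Bool,
      ∑ x₁ : Fin (kk m) → Bool, twist x₁ (pv w x₂) * signOf (x₂ b₀) * (twist x₁ y₁ * twist x₂ y₂)
        = (signOf (x₂ b₀) * twist x₂ y₂) * (if x₂ = qv w y₁ then (2 : ℝ) ^ kk m else 0) := by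
    intro x₂
    have e : ∀ x₁ : Fin (kk m) → Bool, twist x₁ (pv w x₂) * signOf (x₂ b₀) * (twist x₁ y₁ * twist x₂ y₂)
        = (signOf (x₂ b₀) * twist x₂ y₂) * twist x₁ (bxor (pv w x₂) y₁) := fun x₁ => by
      rw [Literature.Computability.QuantumComplexity.BuzetChailloux.twist_bxor_right]; ring
    simp_rw [e]
    rw [← mul_sum, BuzetChailloux.sum_twist_left]
    simp only [BuzetChailloux.bxor_eq_zeroVec_iff, pv_eq_iff]
  simp_rw [inner, mul_ite, mul_zero, Finset.sum_ite_eq', Finset.mem_univ, if_true]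
  ring

/-- `q = π_w⁻¹(y′)` in `𝔽₂`: `q_b = Σ_a R(b,a) y′_a + z_b`. -/
theorem bit_qv (y₁ : Fin (kk m) → Bool) (b : Fin (kk m)) :
    bit (qv w y₁ b) = ∑ a, bit (rEnt w b a) * bit (y₁ a) + bit (zv w b) := by
  obtain ⟨⟨r, s⟩, rfl⟩ := nd.surjective b
  simp only [qv, ofNV, zv, rEnt, Equiv.symm_apply_apply]
  rw [bit_nsolve_expand, ← Equiv.sum_comp (nd (m := m)).symm]
  simp only [toNV, Prod.mk.eta, Equiv.apply_symm_apply]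
  have e : ∀ a : Fin (kk m), bit (bxor y₁ (sgl a₀) a) = bit (y₁ a) + bit (decide (a = a₀)) := fun a => by
    rw [show bxor y₁ (sgl a₀) a = xor (y₁ a) (sgl a₀ a) from rfl, bit_xor]; rfl
  simp_rw [e, add_mul, sum_add_distrib]
  rw [sum_bit_decide_eq_mul']
  congr 1
  exact sum_congr rfl fun a _ => mul_comm _ _

/-- ★ `G₀` PRESENTS THE DUAL: `G₀(y′,y″) = q_{b₀} ⊕ ⟨q, y″⟩`. -/
theorem eval_G0 (y₁ y₂ : Fin (kk m) → Bool) : (G0 w).eval (Fin.append y₁ y₂) = xor (qv w y₁ b₀) (bd (qv w y₁) y₂) := by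
  apply bit_injective
  rw [G0, bit_eval_blTable, bit_xor, bit_bd, bit_qv]
  simp_rw [bit_qv]
  simp only [add_mul, sum_add_distrib, sum_mul]
  rw [sum_comm]
  have e : ∀ a b : Fin (kk m), bit (rEnt w b a) * (bit (y₁ a) * bit (y₂ b)) = bit (rEnt w b a) * bit (y₁ a) * bit (y₂ b) :=
    fun a b => by ring
  simp only [e]
  ring

/-- ★★ `G₀` IS THE DUAL OF `F_w`; hence `Φ(F_w, G₀) = 1`. -/
theorem isDualOf_Fw_G0 : IsDualOf (Fw w).eval (G0 w).eval := by
  intro y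
  obtain ⟨⟨y₁, y₂⟩, rfl⟩ := (Fin.appendEquiv (kk m) (kk m)).surjective y
  show W _ (Fin.append y₁ y₂) = _ * signOf ((G0 w).eval (Fin.append y₁ y₂))
  rw [W_Fw, eval_G0, signOf_xor, signOf_bd, SgnForrMem.sqrt_two_pow_add_self]

/-- HintDial helper `value_G0` (lens-3 g6 HintDial THEOREMS package; see the enclosing section docstring). -/
theorem value_G0 : (⟨kk m + kk m, Fw w, G0 w⟩ : CubicANFPair).value = 1 :=
  forrelation_eq_one_of_isDualOf (isDualOf_Fw_G0 w)

/-- ★★ THE DUAL BIT IS `MOD₃(w)`. -/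
theorem G0_const : (G0 w).const = decide (GateFn.numOnes w % 3 = 0) := by
  show zv w b₀ = _
  simp only [zv, rEnt, ofNV, a₀, b₀, Equiv.symm_apply_apply]
  exact nsolve_single_origin_last w

/-- The dual has no cubic part. -/
theorem G0_noCubic (i j l : Fin (kk m + kk m)) (h : 3 ≤ posDeg i j l) : (G0 w).cube i j l = false := by
  cases h' : (G0 w).cube i j l
  · rfl
  · exfalso
    simp only [G0] at h'
    have hij : i = j := blTable_cube_eq_true h'
    have := posDeg_le_two_of_eq (l := l) hij
    omega

/-- ★ THE PLANTED INSTANCE: `F_w` with the HINT-FREE second table (constant `1`, all coefficients `0`). -/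
def inst : CubicANFPair := ⟨kk m + kk m, Fw w, ⟨true, fun _ _ _ => false⟩⟩

/-- HintDial helper `inst_even` (lens-3 g6 HintDial THEOREMS package; see the enclosing section docstring). -/
theorem inst_even : Even (inst w).n := ⟨kk m, rfl⟩

/-- HintDial helper `inst_agree` (lens-3 g6 HintDial THEOREMS package; see the enclosing section docstring). -/
theorem inst_agree : CubeAgreeFrom 3 (inst w).G (G0 w) := fun i j l h => by
  show false = (G0 w).cube i j l; rw [G0_noCubic w i j l h]

/-- HintDial helper `inst_mem_yes` (lens-3 g6 HintDial THEOREMS package; see the enclosing section docstring). -/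
theorem inst_mem_yes (h : GateFn.numOnes w % 3 = 0) : (inst w).encode ∈ (HintSlice 3).yes :=
  ⟨inst w, ⟨inst_even w, G0 w, value_G0 w, by show true = (G0 w).const; rw [G0_const, decide_eq_true h], inst_agree w⟩, rfl⟩

/-- HintDial helper `inst_mem_no` (lens-3 g6 HintDial THEOREMS package; see the enclosing section docstring). -/
theorem inst_mem_no (h : ¬ GateFn.numOnes w % 3 = 0) : (inst w).encode ∈ (HintSlice 3).no :=
  ⟨inst w, ⟨inst_even w, G0 w, value_G0 w, by show true = !(G0 w).const; rw [G0_const, decide_eq_false h]; rfl,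
    inst_agree w⟩, rfl⟩

/-! ### The instance code is a LITERAL PROJECTION of `w` -/

/-- Code symbols: a constant, or a possibly negated input bit. -/
abbrev Lit (m : ℕ) : Type := Bool ⊕ (Bool × Fin m)

/-- Reading a symbol. -/
def evalLit (w : Fin m → Bool) : Lit m → Bool
  | .inl c => c
  | .inr (ng, i) => xor ng (w i)

/-- `g : {0,1}^m → {0,1}` is a literal (or a constant). -/
def IsLit (g : (Fin m → Bool) → Bool) : Prop := ∃ ℓ : Lit m, ∀ w, g w = evalLit w ℓ

/-- `f : {0,1}^m → {0,1}^*` is a literal projection. -/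
def IsProj (f : (Fin m → Bool) → List Bool) : Prop := ∃ s : List (Lit m), ∀ w, f w = s.map (evalLit w)

/-- HintDial helper `IsLit.const` (lens-3 g6 HintDial THEOREMS package; see the enclosing section docstring). -/
theorem IsLit.const (c : Bool) : IsLit (fun _ : Fin m → Bool => c) := ⟨.inl c, fun _ => rfl⟩

/-- HintDial helper `IsLit.congr` (lens-3 g6 HintDial THEOREMS package; see the enclosing section docstring). -/
theorem IsLit.congr {g g' : (Fin m → Bool) → Bool} (h : IsLit g) (e : ∀ w, g' w = g w) : IsLit g' := by
  obtain ⟨ℓ, hℓ⟩ := h; exact ⟨ℓ, fun w => (e w).trans (hℓ w)⟩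

/-- HintDial helper `IsLit.xor_const` (lens-3 g6 HintDial THEOREMS package; see the enclosing section docstring). -/
theorem IsLit.xor_const (c : Bool) {g : (Fin m → Bool) → Bool} (h : IsLit g) : IsLit fun w => xor c (g w) := by
  obtain ⟨ℓ, hℓ⟩ := h
  rcases ℓ with c' | ⟨ng, i⟩
  · exact ⟨.inl (xor c c'), fun w => by show xor c (g w) = _; rw [hℓ]; rfl⟩
  · exact ⟨.inr (xor c ng, i), fun w => by show xor c (g w) = xor (xor c ng) (w i); rw [hℓ, Bool.xor_assoc]; rfl⟩

/-- HintDial helper `IsLit.const_and` (lens-3 g6 HintDial THEOREMS package; see the enclosing section docstring). -/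
theorem IsLit.const_and (c : Bool) {g : (Fin m → Bool) → Bool} (h : IsLit g) : IsLit fun w => c && g w := by
  cases c
  · exact ⟨.inl false, fun w => by simp [evalLit]⟩
  · exact h.congr fun w => Bool.true_and _

/-- HintDial helper `IsLit.not` (lens-3 g6 HintDial THEOREMS package; see the enclosing section docstring). -/
theorem IsLit.not {g : (Fin m → Bool) → Bool} (h : IsLit g) : IsLit fun w => !(g w) :=
  (h.xor_const true).congr fun w => by cases g w <;> rfl

/-- HintDial helper `isLit_wN` (lens-3 g6 HintDial THEOREMS package; see the enclosing section docstring). -/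
theorem isLit_wN (t : ℕ) : IsLit fun w : Fin m → Bool => wN w t := by
  unfold wN
  by_cases h : t < m
  · exact ⟨.inr (false, ⟨t, h⟩), fun w => by simp [h, evalLit]⟩
  · exact ⟨.inl false, fun w => by simp [h, evalLit]⟩

/-- HintDial helper `isLit_edgeB` (lens-3 g6 HintDial THEOREMS package; see the enclosing section docstring). -/
theorem isLit_edgeB (a b : Nd m) : IsLit fun w : Fin m → Bool => edgeB w a b := by
  unfold edgeB
  refine IsLit.const_and _ ?_
  by_cases h1 : b.2 = a.2
  · exact (isLit_wN (b.1 : ℕ)).not.congr fun w => by rw [if_pos h1]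
  · by_cases h2 : b.2 = a.2 + 1
    · exact (isLit_wN (b.1 : ℕ)).congr fun w => by rw [if_neg h1, if_pos h2]
    · exact (IsLit.const false).congr fun w => by rw [if_neg h1, if_neg h2]

/-- HintDial helper `isLit_qEnt` (lens-3 g6 HintDial THEOREMS package; see the enclosing section docstring). -/
theorem isLit_qEnt (a b : Nd m) : IsLit fun w : Fin m → Bool => qEnt w a b := (isLit_edgeB a b).xor_const _

/-- HintDial helper `isLit_Fw_cube` (lens-3 g6 HintDial THEOREMS package; see the enclosing section docstring). -/
theorem isLit_Fw_cube (i j l : Fin (kk m + kk m)) : IsLit fun w : Fin m → Bool => (Fw w).cube i j l := by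
  unfold Fw blTable
  refine IsLit.const_and _ ?_
  generalize finSumFinEquiv.symm i = u
  generalize finSumFinEquiv.symm l = v
  rcases u with a | b <;> rcases v with a' | b'
  · exact IsLit.const _
  · exact isLit_qEnt _ _
  · exact IsLit.const _
  · exact IsLit.const _

/-- HintDial helper `IsProj.of_const` (lens-3 g6 HintDial THEOREMS package; see the enclosing section docstring). -/
theorem IsProj.of_const {f : (Fin m → Bool) → List Bool} (h : ∀ u v, f u = f v) : IsProj f :=
  ⟨(f fun _ => false).map Sum.inl, fun u => by
    rw [h u fun _ => false, List.map_map]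
    exact (List.map_id'' (fun c => (rfl : (evalLit u ∘ Sum.inl) c = c)) _).symm⟩

/-- HintDial helper `IsProj.const` (lens-3 g6 HintDial THEOREMS package; see the enclosing section docstring). -/
theorem IsProj.const (c : List Bool) : IsProj (m := m) fun _ => c := IsProj.of_const fun _ _ => rfl

/-- HintDial helper `IsProj.single` (lens-3 g6 HintDial THEOREMS package; see the enclosing section docstring). -/
theorem IsProj.single {g : (Fin m → Bool) → Bool} (h : IsLit g) : IsProj fun w => [g w] := by
  obtain ⟨ℓ, hℓ⟩ := h; exact ⟨[ℓ], fun w => by show [g w] = _; rw [hℓ]; rfl⟩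

/-- HintDial helper `IsProj.append` (lens-3 g6 HintDial THEOREMS package; see the enclosing section docstring). -/
theorem IsProj.append {f g : (Fin m → Bool) → List Bool} (hf : IsProj f) (hg : IsProj g) :
    IsProj fun u => f u ++ g u := by
  obtain ⟨s, hs⟩ := hf; obtain ⟨s', hs'⟩ := hg
  exact ⟨s ++ s', fun u => by rw [List.map_append, ← hs, ← hs']⟩

/-- HintDial helper `IsProj.double` (lens-3 g6 HintDial THEOREMS package; see the enclosing section docstring). -/
theorem IsProj.double {f : (Fin m → Bool) → List Bool} (hf : IsProj f) :
    IsProj fun u => (f u).flatMap fun b => [b, b] := by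
  obtain ⟨s, hs⟩ := hf
  refine ⟨s.flatMap fun σ => [σ, σ], fun u => ?_⟩
  show (f u).flatMap _ = _
  rw [hs]
  clear hs
  induction s with
  | nil => rfl
  | cons σ s ih => simp [List.flatMap_cons, ih]

/-- HintDial helper `IsProj.boolPair` (lens-3 g6 HintDial THEOREMS package; see the enclosing section docstring). -/
theorem IsProj.boolPair {f g : (Fin m → Bool) → List Bool} (hf : IsProj f) (hg : IsProj g) :
    IsProj fun u => boolPair (f u) (g u) :=
  (hf.double.append (IsProj.const [false, true])).append hg

/-- HintDial helper `IsProj.ofFn` (lens-3 g6 HintDial THEOREMS package; see the enclosing section docstring). -/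
theorem IsProj.ofFn {j : ℕ} (g : Fin j → (Fin m → Bool) → Bool) (hg : ∀ l, IsProj fun u => [g l u]) :
    IsProj fun u => List.ofFn fun l => g l u := by
  induction j with
  | zero => simp only [List.ofFn_zero]; exact IsProj.const []
  | succ j ih =>
    simp only [List.ofFn_succ]
    exact (hg 0).append (ih (fun l => g l.succ) fun l => hg l.succ)

/-- HintDial helper `IsProj.encodeCodeList` (lens-3 g6 HintDial THEOREMS package; see the enclosing section docstring). -/
theorem IsProj.encodeCodeList {j : ℕ} (g : Fin j → (Fin m → Bool) → List Bool) (hg : ∀ l, IsProj (g l)) :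
    IsProj fun u => encodeCodeList (List.ofFn fun l => g l u) := by
  induction j with
  | zero => simp only [List.ofFn_zero]; exact IsProj.const _
  | succ j ih =>
    simp only [List.ofFn_succ]
    exact (hg 0).boolPair (ih (fun l => g l.succ) fun l => hg l.succ)

/-- HintDial helper `isProj_encode_form` (lens-3 g6 HintDial THEOREMS package; see the enclosing section docstring). -/
theorem isProj_encode_form {N : ℕ} (Φ : (Fin m → Bool) → CubicForm N) (c : Bool) (hc : ∀ w, (Φ w).const = c)
    (hcube : ∀ i j l, IsLit fun w => (Φ w).cube i j l) : IsProj fun w => (Φ w).encode := by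
  unfold CubicForm.encode
  simp_rw [hc]
  exact (IsProj.const [c]).boolPair (IsProj.encodeCodeList
    (fun i w => encodeCodeList (List.ofFn fun j => List.ofFn fun l => (Φ w).cube i j l))
    fun i => IsProj.encodeCodeList (fun j w => List.ofFn fun l => (Φ w).cube i j l)
      fun j => IsProj.ofFn (fun l w => (Φ w).cube i j l) fun l => IsProj.single (hcube i j l))

/-- ★ `w ↦ code(inst w)` IS A LITERAL PROJECTION. -/
theorem isProj_encode_inst : IsProj fun w : Fin m → Bool => (inst w).encode := by
  unfold CubicANFPair.encode
  exact (IsProj.const (encodeNat (kk m + kk m))).boolPair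
    ((isProj_encode_form (fun w => Fw w) false (fun _ => rfl) isLit_Fw_cube).boolPair
      (isProj_encode_form (fun _ => ((⟨true, fun _ _ _ => false⟩ : CubicForm (kk m + kk m)))) true (fun _ => rfl)
        fun _ _ _ => IsLit.const false))

/-! ### Code length -/

/-- HintDial helper `length_encodeCodeList` (lens-3 g6 HintDial THEOREMS package; see the enclosing section docstring). -/
theorem length_encodeCodeList (l : List (List Bool)) :
    (encodeCodeList l).length = (l.map fun v => 2 * v.length + 2).sum := by
  induction l with
  | nil => rfl
  | cons v l ih =>
    show (Literature.Computability.Complexity.boolPair v (encodeCodeList l)).length = _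
    rw [length_boolPair, ih, List.map_cons, List.sum_cons]

/-- HintDial helper `length_encode_cubicForm` (lens-3 g6 HintDial THEOREMS package; see the enclosing section docstring). -/
theorem length_encode_cubicForm {N : ℕ} (F : CubicForm N) : F.encode.length = 4 * N ^ 3 + 4 * N ^ 2 + 2 * N + 4 := by
  rw [CubicForm.encode, length_boolPair, length_encodeCodeList, List.map_ofFn, List.sum_ofFn]
  simp_rw [Function.comp_def, length_encodeCodeList, List.map_ofFn, List.sum_ofFn, Function.comp_def,
    List.length_ofFn, sum_const, card_univ, Fintype.card_fin, smul_eq_mul, List.length_singleton]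
  ring

/-- the length bound `12 n³ + 12 n² + 8 n + 16` in `n = I.n`. -/
def lenB (n : ℕ) : ℕ := 12 * n ^ 3 + 12 * n ^ 2 + 8 * n + 16

/-- HintDial helper `length_encode_pair_le` (lens-3 g6 HintDial THEOREMS package; see the enclosing section docstring). -/
theorem length_encode_pair_le (I : CubicANFPair) : I.encode.length ≤ lenB I.n := by
  have h := Literature.Barriers.QuantumAdvantage.TQBFEval.length_encodeNat_le I.n
  rw [CubicANFPair.encode, length_boolPair, length_boolPair, length_encode_cubicForm, length_encode_cubicForm, lenB]
  omega

/-- the length-bounding polynomial in `m` (`n = 6m + 6`). -/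
def uPoly : Polynomial ℕ :=
  (Polynomial.C 12 * Polynomial.X ^ 3 + Polynomial.C 12 * Polynomial.X ^ 2 + Polynomial.C 8 * Polynomial.X + Polynomial.C 16).comp
    (Polynomial.C 6 * Polynomial.X + Polynomial.C 6)

/-- HintDial helper `uPoly_eval` (lens-3 g6 HintDial THEOREMS package; see the enclosing section docstring). -/
theorem uPoly_eval (j : ℕ) : uPoly.eval j = lenB (6 * j + 6) := by
  simp [uPoly, lenB]

/-- HintDial helper `length_encode_inst_le` (lens-3 g6 HintDial THEOREMS package; see the enclosing section docstring). -/
theorem length_encode_inst_le : (inst w).encode.length ≤ uPoly.eval m := by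
  rw [uPoly_eval]
  refine (length_encode_pair_le _).trans (le_of_eq ?_)
  show lenB (kk m + kk m) = _
  congr 1; simp only [kk]; ring


end Automaton

end Summit.QuantumAdvantage.QuantumAdvantage.Theorems.HintDial

end
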